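import Summits.Parity.BatemanHorn.Theses.AlmostPrimeZeros
import Summits.Parity.BatemanHorn.Theorems.AlmostPrimeZerosSystemZeroRepulsionPerSystem
import Summits.Parity.BatemanHorn.Theorems.AlmostPrimeZerosSystemZeroRepulsionShiftTiltedMajorant
import Summits.Parity.BatemanHorn.Theorems.AlmostPrimeZerosSystemZeroRepulsionLinearRankinMajorant
import Summits.Parity.BatemanHorn.Theorems.AlmostPrimeZerosSystemZeroRepulsionApTwistedEulerData
import Summits.Parity.BatemanHorn.Theorems.AlmostPrimeZerosSystemZeroRepulsionApLogL
import Summits.Parity.BatemanHorn.Theorems.AlmostPrimeZerosSystemZeroRepulsionApHolRieszBound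
import Summits.Parity.BatemanHorn.Theorems.AlmostPrimeZerosSystemZeroRepulsionApTiltedAssembly
import Literature.NumberTheory.Sieve.BatemanHornProofs

/-!
# `SystemZeroRepulsion` for every LINEAR Bateman–Horn system (`k = 1`, `deg f = 1`) — unconditional
(crux stmt-Parity-11291, line `smooth-rough-lattice-acquisition`, lead c2)

Everything here is PROVED (theorems only, standard axioms).  The crux
`Summit.Parity.BatemanHorn.Theses.AlmostPrimeZeros.SystemZeroRepulsion` asks, for every Bateman–Horn
system `f`, for a bound `T_f(x) = Σ_ρ ‖1 − ρ‖⁻² ≤ C_f` (all `x ≥ 2`) over the roots of the almost-prime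
polynomial `S_x(z) = Σ_{0≤n≤x} z^{s_f(n)}`.  This file CLOSES the crux on the class of systems with one
linear member, `k = 1`, `f = aX + b` (`a ≥ 1`, `(a, b) = 1` forced by the Bateman–Horn hypotheses):

* `stub_apTiltedMajorant` — the one-sided Selberg–Delange majorant in an arithmetic progression, composed
  BY NAME from the landed stubs A `stub_apTwistedEulerData` (p142404), C `stub_apLogL` (p141561),
  D `stub_apHolRieszBound` (p142409), E `stub_apTiltedAssembly`;
* `SystemZeroRepulsion_linearClass` — **the crux for `k = 1`, `deg f₀ ≤ 1`**: the glue
  `stub_repulsionOfTiltedStat` (p140663: Jensen at the free centre + layer cake, radius `L/C`) fed with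
  the Rankin moment `stub_linearRankinMajorant` (p138681) and the tilted majorant — `stub_shiftTiltedMajorant`
  (p140641) for `a = 1`, `stub_apTiltedMajorant` for `a ≥ 2`.

The remaining class (`k ≠ 1` or some `deg f_i ≥ 2`) is the open residue of the crux (route items
stmt-Parity-17114 `DiscMajorantLog`, stmt-Parity-17115 `FarMomentWide`; skeleton
`Cruxes/SystemZeroRepulsion/Lines/smooth_rough_lattice_acquisition.lean`).
-/

noncomputable section

namespace Summit.Parity.BatemanHorn.Cruxes.SystemZeroRepulsion.NearFar

open scoped BigOperators
open Polynomial
open Summit.Parity.BatemanHorn.Theses.AlmostPrimeZeros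

/-- Class `linₐ`: **the one-sided Selberg–Delange majorant in an arithmetic progression** (the
registered stub `stub_apTiltedMajorant` of the crux, skeleton v2), composed from the landed stubs
A, C, D, E by name. -/
theorem stub_apTiltedMajorant :
    ∀ (a b : ℤ), 2 ≤ a → IsCoprime a b → ∃ A : ℝ, 0 ≤ A ∧ ∃ C : ℝ, 0 < C ∧ ∃ x₀ : ℕ, ∀ x : ℕ, x₀ ≤ x → ∀ z : ℂ,
      ‖z - 1‖ ≤ Real.log (Real.log x) / C →
      ‖∑ n ∈ Finset.range (x + 1), z ^ (((a * (n : ℤ) + b).toNat).factorization.sum fun _ v => min v 2)‖ ≤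
        ((x : ℝ) + 1) * Real.exp (Real.log (Real.log x) * (z.re - 1) + A * (1 + ‖z - 1‖) ^ (3 / 2 : ℝ)) :=
  stub_apTiltedAssembly stub_apTwistedEulerData stub_apLogL stub_apHolRieszBound

/-- For a Bateman–Horn system with one LINEAR member `f₀ = aX + b` (`a = coeff 1 > 0`,
`b = coeff 0`): the system statistic is the capped statistic of `an + b`, and `(a, b) = 1`. -/
theorem linear_system_data (f : Fin 1 → Polynomial ℤ)
    (hf : Literature.NumberTheory.Sieve.IsBatemanHornSystem f) (hdeg : (f 0).natDegree ≤ 1) :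
    0 < (f 0).coeff 1 ∧ IsCoprime ((f 0).coeff 1) ((f 0).coeff 0) ∧
      (fun n : ℕ => ∑ i, (((f i).eval (n : ℤ)).toNat.factorization.sum fun _ v => min v 2)) =
        fun n : ℕ => ((((f 0).coeff 1) * (n : ℤ) + (f 0).coeff 0).toNat).factorization.sum fun _ v => min v 2 := by
  have hd1 : (f 0).natDegree = 1 := le_antisymm hdeg (hf.natDegree_pos 0)
  have hg := Polynomial.eq_X_add_C_of_natDegree_le_one hdeg
  set a : ℤ := (f 0).coeff 1 with ha_def
  set b : ℤ := (f 0).coeff 0 with hb_def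
  have ha : 0 < a := by
    have h := hf.leadingCoeff_pos 0
    rwa [Polynomial.leadingCoeff, hd1] at h
  have heval : ∀ n : ℤ, (f 0).eval n = a * n + b := by
    intro n
    conv_lhs => rw [hg]
    simp
  refine ⟨ha, ?_, ?_⟩
  · -- coprimality from `hasNoFixedPrimeDivisor`
    rw [Int.isCoprime_iff_gcd_eq_one]
    by_contra hg1
    set p : ℕ := (Int.gcd a b).minFac with hp_def
    have hp : p.Prime := Nat.minFac_prime hg1
    have hpa : (p : ℤ) ∣ a :=
      (Int.natCast_dvd_natCast.2 (Nat.minFac_dvd _)).trans (Int.gcd_dvd_left _ _)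
    have hpb : (p : ℤ) ∣ b :=
      (Int.natCast_dvd_natCast.2 (Nat.minFac_dvd _)).trans (Int.gcd_dvd_right _ _)
    have hall : ∀ n : ℕ, (p : ℤ) ∣ ∏ i, (f i).eval (n : ℤ) := by
      intro n
      rw [Fin.prod_univ_one, heval]
      exact (hpa.mul_right _).add hpb
    have hcount : Literature.NumberTheory.Sieve.polyRootCountMod f p = p := by
      unfold Literature.NumberTheory.Sieve.polyRootCountMod
      rw [Finset.filter_true_of_mem (fun n _ => hall n), Finset.card_range]
    have hlt := hf.hasNoFixedPrimeDivisor p hp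
    rw [hcount] at hlt
    exact lt_irrefl _ hlt
  · funext n
    rw [Fin.sum_univ_one, heval]

/-- Repackaging of a per-statistic bound `∀ x, T ≤ C` into the crux's conclusion for `f`. -/
theorem crux_conclusion_of_stat_bound {k : ℕ} (f : Fin k → Polynomial ℤ) {s : ℕ → ℕ}
    (hs : (fun n : ℕ => ∑ i, (((f i).eval (n : ℤ)).toNat.factorization.sum fun _ v => min v 2)) = s)
    (hC : ∃ C : ℝ, ∀ x : ℕ,
      ((∑ n ∈ Finset.range (x + 1), (Polynomial.X : Polynomial ℂ) ^ (s n)).roots.map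
        (fun ρ : ℂ => (‖(1 : ℂ) - ρ‖ ^ 2)⁻¹)).sum ≤ C) :
    ∃ C : ℝ, ∀ x : ℕ, 2 ≤ x →
      ((∑ n ∈ Finset.range (x + 1), (Polynomial.X : Polynomial ℂ) ^
          (∑ i, (((f i).eval (n : ℤ)).toNat.factorization.sum fun _ v => min v 2))).roots.map
        (fun ρ : ℂ => (‖(1 : ℂ) - ρ‖ ^ 2)⁻¹)).sum ≤ C := by
  obtain ⟨C, hC⟩ := hC
  refine ⟨C, fun x _ => ?_⟩
  have h := hC x
  rw [← hs] at h
  exact h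

/-- **`SystemZeroRepulsion` for linear systems, unconditionally** (registered helper stub
`stub_linearClassRepulsion` of the crux): for every Bateman–Horn system `f = (f₀)` with `deg f₀ ≤ 1`
there is `C` with `Σ_ρ ‖1 − ρ‖⁻² ≤ C` for all `x ≥ 2`, the sum over the roots of
`S_x(z) = Σ_{0≤n≤x} z^{s(f₀(n))}`.  Route: `f₀ = aX + b` with `a ≥ 1`, `(a,b) = 1` (`linear_system_data`);
the radius-`L/C` reduction `stub_repulsionOfTiltedStat` with the Rankin moment
`stub_linearRankinMajorant` and the tilted majorant `stub_shiftTiltedMajorant` (`a = 1`) /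
`stub_apTiltedMajorant` (`a ≥ 2`). -/
theorem stub_linearClassRepulsion :
    ∀ (f : Fin 1 → Polynomial ℤ), Literature.NumberTheory.Sieve.IsBatemanHornSystem f →
      (f 0).natDegree ≤ 1 →
      ∃ C : ℝ, ∀ x : ℕ, 2 ≤ x →
        ((∑ n ∈ Finset.range (x + 1), (Polynomial.X : Polynomial ℂ) ^
            (∑ i, (((f i).eval (n : ℤ)).toNat.factorization.sum fun _ v => min v 2))).roots.map
          (fun ρ : ℂ => (‖(1 : ℂ) - ρ‖ ^ 2)⁻¹)).sum ≤ C := by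
  intro f hf hdeg
  obtain ⟨ha, hcop, hstat⟩ := linear_system_data f hf hdeg
  set a : ℤ := (f 0).coeff 1 with ha_def
  set b : ℤ := (f 0).coeff 0 with hb_def
  obtain ⟨B, hB0, hrank⟩ := stub_linearRankinMajorant a b ha
  refine crux_conclusion_of_stat_bound f hstat (stub_repulsionOfTiltedStat _ ?_ ⟨B, hB0, hrank⟩)
  by_cases ha1 : a = 1
  · -- class lin₁ : f = X + b
    obtain ⟨A, hA0, C, hC, x₀, hmaj⟩ := stub_shiftTiltedMajorant b
    refine ⟨A, hA0, C, hC, x₀, fun x hx z hz => ?_⟩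
    have h := hmaj x hx z hz
    simpa [ha1] using h
  · -- class linₐ : a ≥ 2
    have ha2 : 2 ≤ a := by omega
    exact stub_apTiltedMajorant a b ha2 hcop

/-- **The crux on the linear class, in the crux's own quantifier shape** (all systems `f : Fin k → ℤ[X]`
with `k = 1` and `deg ≤ 1`). -/
theorem SystemZeroRepulsion_linearClass :
    ∀ (k : ℕ) (f : Fin k → Polynomial ℤ), Literature.NumberTheory.Sieve.IsBatemanHornSystem f →
      (k = 1 ∧ ∀ i, (f i).natDegree ≤ 1) →
      ∃ C : ℝ, ∀ x : ℕ, 2 ≤ x →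
        ((∑ n ∈ Finset.range (x + 1), (Polynomial.X : Polynomial ℂ) ^
            (∑ i, (((f i).eval (n : ℤ)).toNat.factorization.sum fun _ v => min v 2))).roots.map
          (fun ρ : ℂ => (‖(1 : ℂ) - ρ‖ ^ 2)⁻¹)).sum ≤ C := by
  intro k f hf hcls
  obtain ⟨rfl, hdeg⟩ := hcls
  exact stub_linearClassRepulsion f hf (hdeg 0)

end Summit.Parity.BatemanHorn.Cruxes.SystemZeroRepulsion.NearFar

end
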